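import Summits.QuantumFields.BalabanUV.Beta.GAN24.Push3BorderGaugeSlotCellsRight
import Summits.QuantumFields.BalabanUV.Beta.GAN24.Push3LegTelescope

/-!
# `GAN24.ContactBorderKernelCells` — CT-ROUTE «CT-3cV-KERNEL» (the row owner's `BORNSEC-PLAN-v0.md` item (V6), border half): THE CONTACT TERM OF EACH MIXED
# CHANNEL OF THE BORDER TABLE `push[T, M, T](V) − push[B, M, B](V)` IS THE SUM OF TWO ONE-GAUGE BORDER CELLS (gauge in each FIELD slot; the multiplier leg
# carries no dressing) — generic sockets on the summable class

HONEST FRAMING (cell charter, verbatim): «discharging `BetaPertH` makes Bałaban's UV stability UNCONDITIONAL — a real constructive-QFT result;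
it is NOT the continuum limit and NOT the Clay problem.»  DERIVED cell leaf (pub-balaban, G-an2-4 formalisation swarm → CRUX TEAM (2), seat
`b2b-balaban-gan24-formalise-leaf-02`, gen 47): leaf-01 g58's `ContactKernelCells.contact_ff_eq_cells` script (one-leg-at-a-time telescoping `Push3LegTelescope.push₃_sub_*`
on the summable class, then the slot readings) re-run for the two mixed channels of leaf-01 g43's `RespStepBm.e3K_coDressKBmAt_KStepUnit` at the border table, with
this lineage's slot readings `Push3BorderGaugeSlotCells(Right)` BY NAME; [folklore] bookkeeping; NO cited fact, NO `def`, NO `def … : Prop`, NO wall binder.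
Discharges NO letter of (CONV-C): the route's INSTANCE (legs `∓respStepBm…` chains ∕ `colM` ∕ `rowMM` of `KStepUnit`, gauge functions from
`DressedLegUnits.legAct_legChain_eq_add_dz`) and the assembly (V8) are the owner's ∕ leaf-03's; NEVER «G-an2-4 closed»; NOT hS0, NOT D1, NOT `BetaPertH`, NOT
continuum, NOT Clay.  «not in print; our bookkeeping».
HONEST DEPENDENCY (cell records, verbatim): «continuum YM on T⁴ ⇐ BetaPertH ∧ nine spine estimates (0/9 proved); BetaPertH ⇐ (D1) ∧ (D4) ∧ CAP+tail;
G-an2-4 gates asym, D1 and NE2/3/4.»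
ABSOLUTE RULE (cell charter, verbatim): «No internally-minted statement may enter as a cited fact. Every hypothesis is either kernel-proved in this
package or a verbatim quotation of a PUBLISHED theorem with page reference. The manuscript(s) under audit are NOT citable for their own disputed steps —
they are the thing under adjudication; programme-internal (2001/route/tribunal) claims are never citable.»

## What is proved (box root `ρ = toSite rr`, `rr ∈ box (d+1) L`, `1 ≤ L`; `V = vhSAt ρ d L`, `q = linSymAt ρ L`; generic `d`)
* §1 `locStencil_reslot_vhSAt` — every re-slotted channel of the border table is a local stencil family (rate `1`; an1's `locStencil_vhSAt`, leaf-01's `locStencil_reslot`).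
* §2 **`contact_border_fm_eq_cells`** — channel `reslot inl inr V` (legs: LEFT = dressed field leg `lᴱ`∕`lᴮ` with `lᴱ − lᴮ = dz λ_L`, RIGHT = the COMMON undressed multiplier
  leg `M`, TABLE = dressed `wᴱ`∕`wᴮ` with `wᴱ − wᴮ = dz λ_W`; summable class): `push₃ lᴱ M wᴱ S − push₃ lᴮ M wᴮ S` `(x′, z′, inl α, inl β)`
  `= Σ'_z Σ_μ M β z′ μ z · Σ'_u Σ_κ wᴱ κ′ u′ κ u · ((λ_L αx′ (u + e_κ) − λ_L αx′ (z + ρ + L·e_μ))·q(u,z)(inl κ)(inr μ))`   (LEFT cell; partners `M, wᴱ`)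
  `+ Σ'_z Σ_μ M β z′ μ z · Σ'_x Σ_a lᴮ α x′ a x · ((λ_W κ′u′ (z + ρ) − λ_W κ′u′ x)·q(x,z)(inl a)(inr μ))`            (TABLE cell; partners `lᴮ, M`)
  — both in the nesting of `Push3BorderGaugeSlotCells.abs_cellVflu_le'` ∕ `abs_cellVidx_le'` (multiplier leg OUTER).
* §3 **`contact_border_mf_eq_cells`** — channel `reslot inr inl V` (LEFT = the common undressed multiplier rows `M`, bounded with summable fine rows; RIGHT = dressed
  `rᴱ`∕`rᴮ`, `rᴱ − rᴮ = dz λ_R`; TABLE = dressed `wᴱ`∕`wᴮ`): `= Σ'_x Σ_a M α x′ a x · Σ'_u Σ_κ wᴱ κ′ u′ κ u · ((λ_R βz′ (u + e_κ) − λ_R βz′ (x + ρ + L·e_a))·q(u,x)(inl κ)(inr a))`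
  (RIGHT cell, `abs_cellVflu_le'`) `+ Σ'_z Σ_b rᴮ β z′ b z · Σ'_x Σ_a M α x′ a x · ((λ_W κ′u′ (x + ρ) − λ_W κ′u′ z)·q(z,x)(inl b)(inr a))` (TABLE cell, fine leg outer,
  `Push3BorderGaugeSlotCellsRight.abs_cellVidx_le''`).
Provenance: seat b2b-balaban-gan24-formalise-leaf-02 gen 47 (prover-…-leaf-02-g47-0), 2026-08-21; over the files named above BY NAME.
-/

open Finset
open scoped BigOperators Nat
open Literature.MathematicalPhysics.QuantumFieldTheory.Balaban1983to89
open Literature.MathematicalPhysics.QuantumFieldTheory.Balaban1983to89.Beta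
open AffineAveraging AveragingContours AveragingHessianKernels AveragingContoursRooted AveragingHessianKernelsRooted
open ExpKernelCalculus (MKer)
open OneStepResolventKernel (Fib LocStencil)
open Summit.QuantumFields.BalabanUV.Beta.AveragingWardRootedStencils (linSymAt)
open Summit.QuantumFields.BalabanUV.Beta.GAN24.Push3 (push₃)
open Summit.QuantumFields.BalabanUV.Beta.GAN24.SrecLinearPartEq (reslot locStencil_reslot)
open Summit.QuantumFields.BalabanUV.Beta.GAN24.Push3LegTelescope (push₃_sub_left push₃_sub_right push₃_sub_table)
open Summit.QuantumFields.BalabanUV.Beta.GAN24.Push3BorderGaugeSlotCells (push₃_gaugeLeft_border push₃_gaugeTable_border)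
open Summit.QuantumFields.BalabanUV.Beta.GAN24.Push3BorderGaugeSlotCellsRight (push₃_gaugeTable_border' push₃_gaugeRight_border)

noncomputable section

namespace Summit.QuantumFields.BalabanUV.Beta.GAN24.ContactBorderKernelCells

variable {d : ℕ}

/-! ## §1 The re-slotted border channels are local stencil families -/

/-- [folklore] Every re-slotted channel of the rooted border table (box root) is a `LocStencil` family at rate `1`. -/
theorem locStencil_reslot_vhSAt {L : ℕ} (hL : 1 ≤ L) {rr : Fin (d + 1) → ℕ} (hrr : rr ∈ box (d + 1) L) (σ τ : Fin (d + 1) → Fib d) :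
    LocStencil (reslot σ τ (vhSAt (toSite rr) d L rfl)) (3 * (ell (d + 1) L : ℝ) ^ 2 * Real.exp (4 * ((d : ℝ) + 1) * L * 1)) 1 :=
  locStencil_reslot (locStencil_vhSAt hL hrr zero_le_one) σ τ

/-! ## §2 The field–multiplier channel `reslot inl inr V` -/

section FM

variable {lE lB M wE wB : Fin (d + 1) → (Fin (d + 1) → ℤ) → Fin (d + 1) → (Fin (d + 1) → ℤ) → ℝ}
variable {lamL lamW : Fin (d + 1) → (Fin (d + 1) → ℤ) → (Fin (d + 1) → ℤ) → ℝ} {ClE ClB CwE CwB : ℝ}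

/-- [folklore] **THE CONTACT TERM OF THE FIELD–MULTIPLIER CHANNEL IS TWO ONE-GAUGE BORDER CELLS** (summable class; the multiplier leg `M` common to both readings):
`push₃ lᴱ M wᴱ S − push₃ lᴮ M wᴮ S = [LEFT cell, partners M, wᴱ, gauge λ_L] + [TABLE cell, partners lᴮ, M, gauge λ_W]`, `S = reslot inl inr V`. -/
theorem contact_border_fm_eq_cells {L : ℕ} (hL : 1 ≤ L) {rr : Fin (d + 1) → ℕ} (hrr : rr ∈ box (d + 1) L)
    (hlE : ∀ α x' κ x, |lE α x' κ x| ≤ ClE) (hlEs : ∀ α x' κ, Summable fun x => lE α x' κ x)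
    (hlB : ∀ α x' κ x, |lB α x' κ x| ≤ ClB) (hlBs : ∀ α x' κ, Summable fun x => lB α x' κ x)
    (hMs : ∀ β z' κ, Summable fun z => M β z' κ z)
    (hwE : ∀ κ' u' κ u, |wE κ' u' κ u| ≤ CwE) (hwB : ∀ κ' u' κ u, |wB κ' u' κ u| ≤ CwB)
    (hLg : lE - lB = fun μ y κ u => dz (lamL μ y) κ u) (hWg : wE - wB = fun μ y κ u => dz (lamW μ y) κ u)
    (κ' : Fin (d + 1)) (u' x' z' : Fin (d + 1) → ℤ) (α β : Fin (d + 1)) :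
    push₃ lE M wE (reslot Sum.inl Sum.inr (vhSAt (toSite rr) d L rfl)) κ' u' x' z' (Sum.inl α) (Sum.inl β)
        - push₃ lB M wB (reslot Sum.inl Sum.inr (vhSAt (toSite rr) d L rfl)) κ' u' x' z' (Sum.inl α) (Sum.inl β)
      = (∑' z, ∑ μ, M β z' μ z * ∑' u, ∑ κ, wE κ' u' κ u *
            ((lamL α x' (u + unitVec κ) - lamL α x' (z + toSite rr + (L : ℤ) • unitVec μ)) * linSymAt (toSite rr) L u z (Sum.inl κ) (Sum.inr μ)))
        + (∑' z, ∑ μ, M β z' μ z * ∑' x, ∑ a, lB α x' a x *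
            ((lamW κ' u' (z + toSite rr) - lamW κ' u' x) * linSymAt (toSite rr) L x z (Sum.inl a) (Sum.inr μ))) := by
  have hS := locStencil_reslot_vhSAt hL hrr Sum.inl Sum.inr
  have h1 := push₃_sub_left hlE hlEs hlB hlBs hMs hwE hS one_pos κ' u'
  have h2 := push₃_sub_table hlB hlBs hMs hwE hwB hS one_pos κ' u'
  have e1 := congrFun (congrFun (congrFun (congrFun h1 x') z') (Sum.inl α)) (Sum.inl β)
  have e2 := congrFun (congrFun (congrFun (congrFun h2 x') z') (Sum.inl α)) (Sum.inl β)
  simp only [Pi.sub_apply] at e1 e2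
  have e : push₃ lE M wE (reslot Sum.inl Sum.inr (vhSAt (toSite rr) d L rfl)) κ' u' x' z' (Sum.inl α) (Sum.inl β)
        - push₃ lB M wB (reslot Sum.inl Sum.inr (vhSAt (toSite rr) d L rfl)) κ' u' x' z' (Sum.inl α) (Sum.inl β)
      = push₃ (lE - lB) M wE (reslot Sum.inl Sum.inr (vhSAt (toSite rr) d L rfl)) κ' u' x' z' (Sum.inl α) (Sum.inl β)
        + push₃ lB M (wE - wB) (reslot Sum.inl Sum.inr (vhSAt (toSite rr) d L rfl)) κ' u' x' z' (Sum.inl α) (Sum.inl β) := by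
    rw [e1, e2]; ring
  rw [e, hLg, hWg, push₃_gaugeLeft_border M wE lamL hL hrr, push₃_gaugeTable_border lB M lamW hL hrr]

end FM

/-! ## §3 The multiplier–field channel `reslot inr inl V` -/

section MF

variable {M rE rB wE wB : Fin (d + 1) → (Fin (d + 1) → ℤ) → Fin (d + 1) → (Fin (d + 1) → ℤ) → ℝ}
variable {lamR lamW : Fin (d + 1) → (Fin (d + 1) → ℤ) → (Fin (d + 1) → ℤ) → ℝ} {CM CrE CrB CwE CwB : ℝ}

/-- [folklore] **THE CONTACT TERM OF THE MULTIPLIER–FIELD CHANNEL IS TWO ONE-GAUGE BORDER CELLS** (summable class; the multiplier rows `M` common, bounded with summable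
fine rows; the dressed right legs bounded with summable slices): `push₃ M rᴱ wᴱ S − push₃ M rᴮ wᴮ S = [RIGHT cell, partners M, wᴱ, gauge λ_R] + [TABLE cell,
partners rᴮ, M, gauge λ_W]`, `S = reslot inr inl V`. -/
theorem contact_border_mf_eq_cells {L : ℕ} (hL : 1 ≤ L) {rr : Fin (d + 1) → ℕ} (hrr : rr ∈ box (d + 1) L)
    (hM : ∀ α x' κ x, |M α x' κ x| ≤ CM) (hMs : ∀ α x' κ, Summable fun x => M α x' κ x)
    (hrE : ∀ β z' κ z, |rE β z' κ z| ≤ CrE) (hrEs : ∀ β z' κ, Summable fun z => rE β z' κ z)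
    (hrB : ∀ β z' κ z, |rB β z' κ z| ≤ CrB) (hrBs : ∀ β z' κ, Summable fun z => rB β z' κ z)
    (hwE : ∀ κ' u' κ u, |wE κ' u' κ u| ≤ CwE) (hwB : ∀ κ' u' κ u, |wB κ' u' κ u| ≤ CwB)
    (hRg : rE - rB = fun μ y κ u => dz (lamR μ y) κ u) (hWg : wE - wB = fun μ y κ u => dz (lamW μ y) κ u)
    (κ' : Fin (d + 1)) (u' x' z' : Fin (d + 1) → ℤ) (α β : Fin (d + 1)) :
    push₃ M rE wE (reslot Sum.inr Sum.inl (vhSAt (toSite rr) d L rfl)) κ' u' x' z' (Sum.inl α) (Sum.inl β)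
        - push₃ M rB wB (reslot Sum.inr Sum.inl (vhSAt (toSite rr) d L rfl)) κ' u' x' z' (Sum.inl α) (Sum.inl β)
      = (∑' x, ∑ a, M α x' a x * ∑' u, ∑ κ, wE κ' u' κ u *
            ((lamR β z' (u + unitVec κ) - lamR β z' (x + toSite rr + (L : ℤ) • unitVec a)) * linSymAt (toSite rr) L u x (Sum.inl κ) (Sum.inr a)))
        + (∑' z, ∑ b, rB β z' b z * ∑' x, ∑ a, M α x' a x *
            ((lamW κ' u' (x + toSite rr) - lamW κ' u' z) * linSymAt (toSite rr) L z x (Sum.inl b) (Sum.inr a))) := by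
  have hS := locStencil_reslot_vhSAt hL hrr Sum.inr Sum.inl
  -- the gauge increments of the right slot are bounded (difference of two bounded families)
  have hgR : ∀ μ y κ u, |dz (lamR μ y) κ u| ≤ CrE + CrB := by
    intro μ y κ u
    have e : dz (lamR μ y) κ u = (rE - rB) μ y κ u := by rw [hRg]
    rw [e, Pi.sub_apply, Pi.sub_apply, Pi.sub_apply, Pi.sub_apply]
    exact (abs_sub _ _).trans (add_le_add (hrE μ y κ u) (hrB μ y κ u))
  have h1 := push₃_sub_right hM hrEs hrBs hwE hS one_pos κ' u'
  have h2 := push₃_sub_table hM hMs hrBs hwE hwB hS one_pos κ' u'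
  have e1 := congrFun (congrFun (congrFun (congrFun h1 x') z') (Sum.inl α)) (Sum.inl β)
  have e2 := congrFun (congrFun (congrFun (congrFun h2 x') z') (Sum.inl α)) (Sum.inl β)
  simp only [Pi.sub_apply] at e1 e2
  have e : push₃ M rE wE (reslot Sum.inr Sum.inl (vhSAt (toSite rr) d L rfl)) κ' u' x' z' (Sum.inl α) (Sum.inl β)
        - push₃ M rB wB (reslot Sum.inr Sum.inl (vhSAt (toSite rr) d L rfl)) κ' u' x' z' (Sum.inl α) (Sum.inl β)
      = push₃ M (rE - rB) wE (reslot Sum.inr Sum.inl (vhSAt (toSite rr) d L rfl)) κ' u' x' z' (Sum.inl α) (Sum.inl β)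
        + push₃ M rB (wE - wB) (reslot Sum.inr Sum.inl (vhSAt (toSite rr) d L rfl)) κ' u' x' z' (Sum.inl α) (Sum.inl β) := by
    rw [e1, e2]; ring
  rw [e, hRg, hWg, push₃_gaugeRight_border hL hrr hMs hgR hwE, push₃_gaugeTable_border' M rB lamW hL hrr]

end MF

end Summit.QuantumFields.BalabanUV.Beta.GAN24.ContactBorderKernelCells

end
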